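import Summits.QuantumFields.YangMills.Theorems.VirialFluxGapRegularityCutoff
import Summits.QuantumFields.YangMills.Theorems.VirialFluxGapResolventFieldCutoff
import Summits.QuantumFields.YangMills.Theorems.VirialFluxGapResolventFieldStep
import Summits.QuantumFields.YangMills.Theorems.VirialFluxGapResolventFieldCoefficients
import Summits.QuantumFields.YangMills.Theorems.VirialFluxGapResolventFieldGenericScaled
import HarnessLib

/-!
# Route `VirialFluxGap` (YangMills): PATCHING CALCULUS for the Euler field on `X_fix` — derivative letters of the three cut-offs
# (deficit level `ψ(F/t₀)`, regularity `χ_reg`, determinant localiser `θ`) and the SIGNED form of the regularity cross term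

Toward the deciding crux `VirialFluxGap.PeriodicSoftness` (item stmt-QuantumFields-24141).  The assembled field is
`c_va = ψ(F/t₀)·(χ_reg·c¹_va + (1 − χ_reg)·c²_va)` with `c¹ = θ·(H + λ⋆1)⁻¹g` the det-localised resolvent field (fcl-p3) and `c²` the central
field (w3); w2's ✓`frameD_patch` produces the cross term `Σ_va ∂_vaχ_reg·(c¹ − c²)_va`, which is NOT small in absolute value on the collar
(`|c²| ≈ |z|/2 ≳ ρ/3` there) but is ONE-SIGNED up to `O(√F₀)`: this file supplies the letters.

* §1 the smooth step: `deriv_deficitStep_eq_zero_of_lt_half` ∕ `_of_one_lt` (flat outside `[½,1]`), `exists_bound_deriv_deficitStep`;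
  `frameD_deficitStep_comp` (`∂_Y ψ(f/a) = ψ′(f/a)/a·∂_Y f`);
* §2 ★ `frameD_regCutoff` — the chain rule for w2's ✓`regCutoff`: `∂_Yχ_reg = Σ_k w_k·∂_Y m_k` over the four masses with the EXPLICIT
  weights `w_k = −ψ′(m_k/ρ²)·Π_{l≠k}ψ(m_l/ρ²)/ρ² ≥ 0` (`regWeight_nonneg`, `regWeight_le`: `w_k ≤ D/ρ²`); `frameD_regCutoff_eq_zero_of_core`
  (all masses `< ρ²/2`), `frameD_regCutoff_eq_zero_of_regular` (some mass `> ρ²`); ★★ `regCutoff_cross_le` — the SIGNED CROSS TERM: if along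
  each mass `Σ_va a_va∂_va m_k ≤ A` and `−B ≤ Σ_va b_va∂_va m_k` then `Σ_va ∂_vaχ_reg·(a − b)_va ≤ 4(D/ρ²)(A + B)`;
* §3 the determinant localiser `θ(M) = 1 − ψ(det(H(M)+λ⋆1)²/δ)`: `contDiff_detLocaliser`, `tsupport_detLocaliser_subset` (`⊆ {det ≠ 0}`, so
  ✓`contDiff_resolventCoeff` ∕ ✓`sum_frameD_resolventCoeff` apply to `θ·(A⁻¹g)` with NO hypothesis), `detLocaliser_eq_one` ∕ `frameD_detLocaliser_eq_zero`
  where `det² ≥ 2δ` (invisible at the good points);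
* §4 the deficit-level cut-off `ψ(ringPoly/t₀)`: `= 1` on `{F ≤ t₀/2}`, `= 0` with vanishing frame derivative on `{F > t₀}`, `ψ′ ≠ 0 ⇒ F ≤ t₀`.

HONEST LABEL: calculus letters; no field is assembled here; ⟨24141⟩, ⟨22884⟩ remain OPEN; the Yang–Mills mass gap is NOT proved; no summit is
proved by a line.  THEOREMS ONLY (0 `def`, 0 `sorry`), standard axioms.  Explicit-unit seat `ym-line-fcl-p3` g41 (cell ym-idea-1, free hands),
`--supports stmt-QuantumFields-24141`.  References: [folklore].
-/

set_option autoImplicit false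

noncomputable section

open scoped Matrix BigOperators ContDiff Topology
open MeasureTheory Set Matrix
open Literature.MathematicalPhysics.QuantumFieldTheory hiding SU2
open Literature.MathematicalPhysics.QuantumLattice
open Literature.MathematicalPhysics.QuantumFieldTheory.SUNBakryEmery (expSU coe_expSU matTop)

namespace Summit.QuantumFields.YangMills.Theorems.VirialFluxGap.FrameHessian

open Summit.QuantumFields.YangMills.Theorems.FemtoTransferGap
open Summit.QuantumFields.YangMills.Theorems.FemtoTransferGap.TT
open Summit.QuantumFields.YangMills.Theorems.VirialFluxGap.RingDeficit
open Summit.QuantumFields.YangMills.Theorems.VirialFluxGap.FrameDerivative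
open Summit.QuantumFields.YangMills.Theorems.VirialFluxGap.ResolventField
open Summit.QuantumFields.YangMills.Theorems.VirialFluxGap.RegCutoff

variable {L : ℕ} [NeZero L]

open scoped Matrix.Norms.Frobenius

/-! ## §1 The smooth step: flat zones, a derivative bound, the frame chain rule -/

omit [NeZero L] in
/-- `ψ′ = 0` on `(-∞, ½)` (the step is locally constant `= 1` there). [folklore] -/
theorem deriv_deficitStep_eq_zero_of_lt_half {r : ℝ} (hr : r < 1 / 2) : deriv deficitStep r = 0 := by
  have hev : deficitStep =ᶠ[𝓝 r] fun _ => (1 : ℝ) := by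
    filter_upwards [Iio_mem_nhds hr] with s hs
    exact deficitStep_eq_one (le_of_lt hs)
  rw [hev.deriv_eq, deriv_const]

omit [NeZero L] in
/-- `ψ′ = 0` on `(1, ∞)` (the step is locally constant `= 0` there). [folklore] -/
theorem deriv_deficitStep_eq_zero_of_one_lt {r : ℝ} (hr : 1 < r) : deriv deficitStep r = 0 := by
  have hev : deficitStep =ᶠ[𝓝 r] fun _ => (0 : ℝ) := by
    filter_upwards [Ioi_mem_nhds hr] with s hs
    exact deficitStep_eq_zero (le_of_lt hs)
  rw [hev.deriv_eq, deriv_const]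

omit [NeZero L] in
/-- The derivative of the step is bounded: `∃ D ≥ 0, |ψ′| ≤ D` (continuous, flat outside `[0,1]`). [folklore] -/
theorem exists_bound_deriv_deficitStep : ∃ D : ℝ, 0 ≤ D ∧ ∀ r, |deriv deficitStep r| ≤ D := by
  have hc : Continuous (deriv deficitStep) := contDiff_deficitStep.continuous_deriv (by simp)
  obtain ⟨B, hB⟩ := isCompact_Icc.exists_bound_of_continuousOn (s := Icc (0 : ℝ) 1) hc.continuousOn
  refine ⟨max B 0, le_max_right _ _, fun r => ?_⟩
  by_cases h : r ∈ Icc (0 : ℝ) 1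
  · exact ((Real.norm_eq_abs _).symm.le.trans (hB r h)).trans (le_max_left _ _)
  · rw [mem_Icc, not_and_or, not_le, not_le] at h
    rcases h with h | h
    · rw [deriv_deficitStep_eq_zero_of_lt_half (by linarith), abs_zero]; exact le_max_right _ _
    · rw [deriv_deficitStep_eq_zero_of_one_lt h, abs_zero]; exact le_max_right _ _

/-- Frame chain rule through the step and a scaling: `∂_Y[ψ(f/a)](M) = ψ′(f(M)/a)/a · ∂_Y f(M)` for smooth `f`. [folklore] -/
theorem frameD_deficitStep_comp {f : ((Fin (2 * L - 1 + 1) → Edge 3 L → Matrix (Fin 2) (Fin 2) ℂ) × (Site 3 L → Matrix (Fin 2) (Fin 2) ℂ)) → ℝ}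
    (hf : ContDiff ℝ ∞ f) (a : ℝ) (Y : ((Fin (2 * L - 1 + 1) × Edge 3 L) ⊕ Site 3 L) → Matrix (Fin 2) (Fin 2) ℂ)
    (M : (Fin (2 * L - 1 + 1) → Edge 3 L → Matrix (Fin 2) (Fin 2) ℂ) × (Site 3 L → Matrix (Fin 2) (Fin 2) ℂ)) :
    frameD Y (fun M' => deficitStep (f M' / a)) M = deriv deficitStep (f M / a) / a * frameD Y f M := by
  have hfa : ContDiff ℝ ∞ fun M' => f M' / a := hf.div_const a
  rw [frameD_comp_deriv contDiff_deficitStep hfa]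
  have e : (fun M' => f M' / a) = fun M' => a⁻¹ * f M' := by funext M'; rw [div_eq_inv_mul]
  rw [e, frameD_const_mul Y hf]
  ring

/-! ## §2 The chain rule for `χ_reg`, its signed weights, and the signed cross term -/

/-- ★ **The frame derivative of the regularity cut-off** (w2's ✓`regCutoff ρ = 1 − ψ(m₀/ρ²)ψ(m₁/ρ²)ψ(m₂/ρ²)ψ(m₃/ρ²)`, `m₃` the seam mass):
`∂_Yχ_reg(M) = Σ_k w_k(M)·∂_Y m_k(M)` with `w_k = −ψ′(m_k/ρ²)/ρ² · Π_{l≠k} ψ(m_l/ρ²)`. [folklore] -/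
theorem frameD_regCutoff (ρ : ℝ) (Y : ((Fin (2 * L - 1 + 1) × Edge 3 L) ⊕ Site 3 L) → Matrix (Fin 2) (Fin 2) ℂ)
    (M : (Fin (2 * L - 1 + 1) → Edge 3 L → Matrix (Fin 2) (Fin 2) ℂ) × (Site 3 L → Matrix (Fin 2) (Fin 2) ℂ)) :
    frameD Y (regCutoff ρ) M =
      (-deriv deficitStep (linkMass 0 M / ρ ^ 2) / ρ ^ 2 *
          (deficitStep (linkMass 1 M / ρ ^ 2) * deficitStep (linkMass 2 M / ρ ^ 2) * deficitStep (seamMass M / ρ ^ 2))) *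
        frameD Y (linkMass 0) M +
      (-deriv deficitStep (linkMass 1 M / ρ ^ 2) / ρ ^ 2 *
          (deficitStep (linkMass 0 M / ρ ^ 2) * deficitStep (linkMass 2 M / ρ ^ 2) * deficitStep (seamMass M / ρ ^ 2))) *
        frameD Y (linkMass 1) M +
      (-deriv deficitStep (linkMass 2 M / ρ ^ 2) / ρ ^ 2 *
          (deficitStep (linkMass 0 M / ρ ^ 2) * deficitStep (linkMass 1 M / ρ ^ 2) * deficitStep (seamMass M / ρ ^ 2))) *
        frameD Y (linkMass 2) M +
      (-deriv deficitStep (seamMass M / ρ ^ 2) / ρ ^ 2 *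
          (deficitStep (linkMass 0 M / ρ ^ 2) * deficitStep (linkMass 1 M / ρ ^ 2) * deficitStep (linkMass 2 M / ρ ^ 2))) *
        frameD Y seamMass M := by
  have h0 : ContDiff ℝ ∞ fun M' : (Fin (2 * L - 1 + 1) → Edge 3 L → Matrix (Fin 2) (Fin 2) ℂ) × (Site 3 L → Matrix (Fin 2) (Fin 2) ℂ) =>
      deficitStep (linkMass 0 M' / ρ ^ 2) := contDiff_deficitStep.comp ((contDiff_linkMass 0).div_const _)
  have h1 : ContDiff ℝ ∞ fun M' : (Fin (2 * L - 1 + 1) → Edge 3 L → Matrix (Fin 2) (Fin 2) ℂ) × (Site 3 L → Matrix (Fin 2) (Fin 2) ℂ) =>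
      deficitStep (linkMass 1 M' / ρ ^ 2) := contDiff_deficitStep.comp ((contDiff_linkMass 1).div_const _)
  have h2 : ContDiff ℝ ∞ fun M' : (Fin (2 * L - 1 + 1) → Edge 3 L → Matrix (Fin 2) (Fin 2) ℂ) × (Site 3 L → Matrix (Fin 2) (Fin 2) ℂ) =>
      deficitStep (linkMass 2 M' / ρ ^ 2) := contDiff_deficitStep.comp ((contDiff_linkMass 2).div_const _)
  have h3 : ContDiff ℝ ∞ fun M' : (Fin (2 * L - 1 + 1) → Edge 3 L → Matrix (Fin 2) (Fin 2) ℂ) × (Site 3 L → Matrix (Fin 2) (Fin 2) ℂ) =>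
      deficitStep (seamMass M' / ρ ^ 2) := contDiff_deficitStep.comp (contDiff_seamMass.div_const _)
  have h01 : ContDiff ℝ ∞ fun M' : (Fin (2 * L - 1 + 1) → Edge 3 L → Matrix (Fin 2) (Fin 2) ℂ) × (Site 3 L → Matrix (Fin 2) (Fin 2) ℂ) =>
      deficitStep (linkMass 0 M' / ρ ^ 2) * deficitStep (linkMass 1 M' / ρ ^ 2) := h0.mul h1
  have h012 : ContDiff ℝ ∞ fun M' : (Fin (2 * L - 1 + 1) → Edge 3 L → Matrix (Fin 2) (Fin 2) ℂ) × (Site 3 L → Matrix (Fin 2) (Fin 2) ℂ) =>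
      deficitStep (linkMass 0 M' / ρ ^ 2) * deficitStep (linkMass 1 M' / ρ ^ 2) * deficitStep (linkMass 2 M' / ρ ^ 2) := h01.mul h2
  have e : regCutoff (L := L) ρ = fun M' => 1 - (deficitStep (linkMass 0 M' / ρ ^ 2) * deficitStep (linkMass 1 M' / ρ ^ 2) *
      deficitStep (linkMass 2 M' / ρ ^ 2)) * deficitStep (seamMass M' / ρ ^ 2) := by
    funext M'; rfl
  rw [e, frameD_one_sub, frameD_mul h012 h3, frameD_mul h01 h2, frameD_mul h0 h1,
    frameD_deficitStep_comp (contDiff_linkMass 0), frameD_deficitStep_comp (contDiff_linkMass 1),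
    frameD_deficitStep_comp (contDiff_linkMass 2), frameD_deficitStep_comp contDiff_seamMass]
  ring

omit [NeZero L] in
/-- The regularity weights are non-negative: `0 ≤ −ψ′(r)/ρ² · (product of steps)`. [folklore] -/
theorem regWeight_nonneg (ρ r a b c : ℝ) :
    0 ≤ -deriv deficitStep r / ρ ^ 2 * (deficitStep a * deficitStep b * deficitStep c) := by
  have h1 : 0 ≤ -deriv deficitStep r := by linarith [deriv_deficitStep_nonpos r]
  have h2 : 0 ≤ deficitStep a * deficitStep b * deficitStep c :=
    mul_nonneg (mul_nonneg (deficitStep_nonneg _) (deficitStep_nonneg _)) (deficitStep_nonneg _)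
  exact mul_nonneg (div_nonneg h1 (sq_nonneg _)) h2

omit [NeZero L] in
/-- The regularity weights are bounded: `−ψ′(r)/ρ² · (product of steps) ≤ D/ρ²` when `|ψ′| ≤ D`. [folklore] -/
theorem regWeight_le {D : ℝ} (hD : ∀ r, |deriv deficitStep r| ≤ D) {ρ : ℝ} (hρ : 0 < ρ) (r a b c : ℝ) :
    -deriv deficitStep r / ρ ^ 2 * (deficitStep a * deficitStep b * deficitStep c) ≤ D / ρ ^ 2 := by
  have hρ2 : 0 < ρ ^ 2 := by positivity
  have h1 : -deriv deficitStep r ≤ D := by have := hD r; rw [abs_le] at this; linarith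
  have h1' : 0 ≤ -deriv deficitStep r := by linarith [deriv_deficitStep_nonpos r]
  have h2 : deficitStep a * deficitStep b * deficitStep c ≤ 1 := by
    have := prod4_mem_unit (deficitStep_nonneg a) (deficitStep_le_one a) (deficitStep_nonneg b) (deficitStep_le_one b)
      (deficitStep_nonneg c) (deficitStep_le_one c) zero_le_one le_rfl
    simpa using this.2
  have h2' : 0 ≤ deficitStep a * deficitStep b * deficitStep c :=
    mul_nonneg (mul_nonneg (deficitStep_nonneg _) (deficitStep_nonneg _)) (deficitStep_nonneg _)
  calc -deriv deficitStep r / ρ ^ 2 * (deficitStep a * deficitStep b * deficitStep c)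
      ≤ D / ρ ^ 2 * 1 := by
        apply mul_le_mul (div_le_div_of_nonneg_right h1 hρ2.le) h2 h2' (div_nonneg ((abs_nonneg _).trans (hD 0)) hρ2.le)
    _ = D / ρ ^ 2 := mul_one _

/-- ★ On the `(ρ/√2)`-central CORE (all four masses `< ρ²/2`) the regularity cut-off is flat: `∂_Yχ_reg = 0`. [folklore] -/
theorem frameD_regCutoff_eq_zero_of_core {ρ : ℝ} (hρ : 0 < ρ)
    {M : (Fin (2 * L - 1 + 1) → Edge 3 L → Matrix (Fin 2) (Fin 2) ℂ) × (Site 3 L → Matrix (Fin 2) (Fin 2) ℂ)}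
    (hk : ∀ k : Fin 3, linkMass k M < ρ ^ 2 / 2) (hs : seamMass M < ρ ^ 2 / 2)
    (Y : ((Fin (2 * L - 1 + 1) × Edge 3 L) ⊕ Site 3 L) → Matrix (Fin 2) (Fin 2) ℂ) : frameD Y (regCutoff ρ) M = 0 := by
  have hρ2 : 0 < ρ ^ 2 := by positivity
  have hflat : ∀ {m : ℝ}, m < ρ ^ 2 / 2 → deriv deficitStep (m / ρ ^ 2) = 0 := fun {m} hm =>
    deriv_deficitStep_eq_zero_of_lt_half (by rw [div_lt_iff₀ hρ2]; linarith)
  rw [frameD_regCutoff, hflat (hk 0), hflat (hk 1), hflat (hk 2), hflat hs]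
  ring

/-- ★ Strictly inside the `ρ`-REGULAR region (some mass `> ρ²`) the regularity cut-off is flat: `∂_Yχ_reg = 0`. [folklore] -/
theorem frameD_regCutoff_eq_zero_of_regular {ρ : ℝ} (hρ : 0 < ρ)
    {M : (Fin (2 * L - 1 + 1) → Edge 3 L → Matrix (Fin 2) (Fin 2) ℂ) × (Site 3 L → Matrix (Fin 2) (Fin 2) ℂ)}
    (h : (∃ k : Fin 3, ρ ^ 2 < linkMass k M) ∨ ρ ^ 2 < seamMass M)
    (Y : ((Fin (2 * L - 1 + 1) × Edge 3 L) ⊕ Site 3 L) → Matrix (Fin 2) (Fin 2) ℂ) : frameD Y (regCutoff ρ) M = 0 := by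
  have hρ2 : 0 < ρ ^ 2 := by positivity
  have hgt : ∀ {m : ℝ}, ρ ^ 2 < m → 1 < m / ρ ^ 2 := fun {m} hm => by rw [lt_div_iff₀ hρ2]; linarith
  have hflat : ∀ {m : ℝ}, ρ ^ 2 < m → deriv deficitStep (m / ρ ^ 2) = 0 := fun {m} hm =>
    deriv_deficitStep_eq_zero_of_one_lt (hgt hm)
  have hzero : ∀ {m : ℝ}, ρ ^ 2 < m → deficitStep (m / ρ ^ 2) = 0 := fun {m} hm => deficitStep_eq_zero (hgt hm).le
  rw [frameD_regCutoff]
  rcases h with ⟨k, hk⟩ | hs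
  · have h3 : ∀ i : Fin 3, i = 0 ∨ i = 1 ∨ i = 2 := by decide
    rcases h3 k with rfl | rfl | rfl
    · rw [hflat hk, hzero hk]; ring
    · rw [hflat hk, hzero hk]; ring
    · rw [hflat hk, hzero hk]; ring
  · rw [hflat hs, hzero hs]; ring

/-- ★★ **THE SIGNED CROSS TERM.**  Let `a, b : ι → ℝ` be two coefficient vectors at `M` (the generic and the central field) and `τ` a frame.
If along each of the four masses the `a`-derivative is small, `Σ_va a_va·∂_{τ_va} m_k ≤ A`, and the `b`-field does not shrink the mass by
more than `B`, `−B ≤ Σ_va b_va·∂_{τ_va} m_k`, then the cross term of ✓`frameD_patch` obeys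
`Σ_va ∂_{τ_va}χ_reg·(a_va − b_va) ≤ 4·(D/ρ²)·(A + B)` — no smallness of `b` itself is needed. [folklore] -/
theorem regCutoff_cross_le {ι : Type*} [Fintype ι] (τ : ι → ((Fin (2 * L - 1 + 1) × Edge 3 L) ⊕ Site 3 L) → Matrix (Fin 2) (Fin 2) ℂ)
    {D : ℝ} (hD : ∀ r, |deriv deficitStep r| ≤ D) {ρ : ℝ} (hρ : 0 < ρ)
    (M : (Fin (2 * L - 1 + 1) → Edge 3 L → Matrix (Fin 2) (Fin 2) ℂ) × (Site 3 L → Matrix (Fin 2) (Fin 2) ℂ))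
    (a b : ι → ℝ) {A B : ℝ} (hA0 : 0 ≤ A) (hB0 : 0 ≤ B)
    (hAk : ∀ k : Fin 3, ∑ j, a j * frameD (τ j) (linkMass k) M ≤ A) (hAs : ∑ j, a j * frameD (τ j) seamMass M ≤ A)
    (hBk : ∀ k : Fin 3, -B ≤ ∑ j, b j * frameD (τ j) (linkMass k) M) (hBs : -B ≤ ∑ j, b j * frameD (τ j) seamMass M) :
    ∑ j, frameD (τ j) (regCutoff ρ) M * (a j - b j) ≤ 4 * (D / ρ ^ 2) * (A + B) := by
  -- abbreviations for the four weights
  set w0 := -deriv deficitStep (linkMass 0 M / ρ ^ 2) / ρ ^ 2 *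
      (deficitStep (linkMass 1 M / ρ ^ 2) * deficitStep (linkMass 2 M / ρ ^ 2) * deficitStep (seamMass M / ρ ^ 2)) with hw0
  set w1 := -deriv deficitStep (linkMass 1 M / ρ ^ 2) / ρ ^ 2 *
      (deficitStep (linkMass 0 M / ρ ^ 2) * deficitStep (linkMass 2 M / ρ ^ 2) * deficitStep (seamMass M / ρ ^ 2)) with hw1
  set w2 := -deriv deficitStep (linkMass 2 M / ρ ^ 2) / ρ ^ 2 *
      (deficitStep (linkMass 0 M / ρ ^ 2) * deficitStep (linkMass 1 M / ρ ^ 2) * deficitStep (seamMass M / ρ ^ 2)) with hw2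
  set w3 := -deriv deficitStep (seamMass M / ρ ^ 2) / ρ ^ 2 *
      (deficitStep (linkMass 0 M / ρ ^ 2) * deficitStep (linkMass 1 M / ρ ^ 2) * deficitStep (linkMass 2 M / ρ ^ 2)) with hw3
  have hw0p : 0 ≤ w0 := regWeight_nonneg _ _ _ _ _
  have hw1p : 0 ≤ w1 := regWeight_nonneg _ _ _ _ _
  have hw2p : 0 ≤ w2 := regWeight_nonneg _ _ _ _ _
  have hw3p : 0 ≤ w3 := regWeight_nonneg _ _ _ _ _
  have hw0b : w0 ≤ D / ρ ^ 2 := regWeight_le hD hρ _ _ _ _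
  have hw1b : w1 ≤ D / ρ ^ 2 := regWeight_le hD hρ _ _ _ _
  have hw2b : w2 ≤ D / ρ ^ 2 := regWeight_le hD hρ _ _ _ _
  have hw3b : w3 ≤ D / ρ ^ 2 := regWeight_le hD hρ _ _ _ _
  -- expand the sum
  have hexp : ∑ j, frameD (τ j) (regCutoff ρ) M * (a j - b j) =
      w0 * (∑ j, a j * frameD (τ j) (linkMass 0) M - ∑ j, b j * frameD (τ j) (linkMass 0) M) +
      w1 * (∑ j, a j * frameD (τ j) (linkMass 1) M - ∑ j, b j * frameD (τ j) (linkMass 1) M) +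
      w2 * (∑ j, a j * frameD (τ j) (linkMass 2) M - ∑ j, b j * frameD (τ j) (linkMass 2) M) +
      w3 * (∑ j, a j * frameD (τ j) seamMass M - ∑ j, b j * frameD (τ j) seamMass M) := by
    simp only [frameD_regCutoff, ← hw0, ← hw1, ← hw2, ← hw3, Finset.mul_sum, ← Finset.sum_sub_distrib, ← Finset.sum_add_distrib]
    refine Finset.sum_congr rfl fun j _ => ?_
    ring
  rw [hexp]
  have e0 : w0 * (∑ j, a j * frameD (τ j) (linkMass 0) M - ∑ j, b j * frameD (τ j) (linkMass 0) M) ≤ (D / ρ ^ 2) * (A + B) := by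
    have h : (∑ j, a j * frameD (τ j) (linkMass 0) M - ∑ j, b j * frameD (τ j) (linkMass 0) M) ≤ A + B := by linarith [hAk 0, hBk 0]
    calc _ ≤ w0 * (A + B) := mul_le_mul_of_nonneg_left h hw0p
      _ ≤ (D / ρ ^ 2) * (A + B) := mul_le_mul_of_nonneg_right hw0b (by linarith)
  have e1 : w1 * (∑ j, a j * frameD (τ j) (linkMass 1) M - ∑ j, b j * frameD (τ j) (linkMass 1) M) ≤ (D / ρ ^ 2) * (A + B) := by
    have h : (∑ j, a j * frameD (τ j) (linkMass 1) M - ∑ j, b j * frameD (τ j) (linkMass 1) M) ≤ A + B := by linarith [hAk 1, hBk 1]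
    calc _ ≤ w1 * (A + B) := mul_le_mul_of_nonneg_left h hw1p
      _ ≤ (D / ρ ^ 2) * (A + B) := mul_le_mul_of_nonneg_right hw1b (by linarith)
  have e2 : w2 * (∑ j, a j * frameD (τ j) (linkMass 2) M - ∑ j, b j * frameD (τ j) (linkMass 2) M) ≤ (D / ρ ^ 2) * (A + B) := by
    have h : (∑ j, a j * frameD (τ j) (linkMass 2) M - ∑ j, b j * frameD (τ j) (linkMass 2) M) ≤ A + B := by linarith [hAk 2, hBk 2]
    calc _ ≤ w2 * (A + B) := mul_le_mul_of_nonneg_left h hw2p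
      _ ≤ (D / ρ ^ 2) * (A + B) := mul_le_mul_of_nonneg_right hw2b (by linarith)
  have e3 : w3 * (∑ j, a j * frameD (τ j) seamMass M - ∑ j, b j * frameD (τ j) seamMass M) ≤ (D / ρ ^ 2) * (A + B) := by
    have h : (∑ j, a j * frameD (τ j) seamMass M - ∑ j, b j * frameD (τ j) seamMass M) ≤ A + B := by linarith [hAs, hBs]
    calc _ ≤ w3 * (A + B) := mul_le_mul_of_nonneg_left h hw3p
      _ ≤ (D / ρ ^ 2) * (A + B) := mul_le_mul_of_nonneg_right hw3b (by linarith)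
  linarith

/-! ## §3 The determinant localiser `θ = 1 − ψ(det(H + λ⋆1)²/δ)` -/

section DetLocaliser

variable {ι : Type*} [Fintype ι] [DecidableEq ι]

/-- `det(H(M) + λ⋆1)²` is a smooth function of the coordinates. [folklore] -/
theorem contDiff_det_shiftedHess_sq (τ : ι → ((Fin (2 * L - 1 + 1) × Edge 3 L) ⊕ Site 3 L) → Matrix (Fin 2) (Fin 2) ℂ) (lam : ℝ) :
    ContDiff ℝ ∞ fun M : (Fin (2 * L - 1 + 1) → Edge 3 L → Matrix (Fin 2) (Fin 2) ℂ) × (Site 3 L → Matrix (Fin 2) (Fin 2) ℂ) =>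
      (frameHess (L := L) τ M + lam • (1 : Matrix ι ι ℝ)).det ^ 2 :=
  (contDiff_det_of_entries (contDiff_shiftedHess τ lam)).pow 2

/-- ★ The determinant localiser is smooth. [folklore] -/
theorem contDiff_detLocaliser (τ : ι → ((Fin (2 * L - 1 + 1) × Edge 3 L) ⊕ Site 3 L) → Matrix (Fin 2) (Fin 2) ℂ) (lam δ : ℝ) :
    ContDiff ℝ ∞ fun M : (Fin (2 * L - 1 + 1) → Edge 3 L → Matrix (Fin 2) (Fin 2) ℂ) × (Site 3 L → Matrix (Fin 2) (Fin 2) ℂ) =>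
      1 - deficitStep ((frameHess (L := L) τ M + lam • (1 : Matrix ι ι ℝ)).det ^ 2 / δ) :=
  contDiff_const.sub (contDiff_deficitStep.comp ((contDiff_det_shiftedHess_sq τ lam).div_const δ))

/-- ★ **The localiser lives where the shifted Hessian is invertible**: for `δ > 0`, `tsupport θ ⊆ {det(H + λ⋆1)² ≥ δ/2} ⊆ {det ≠ 0}` — so
✓`contDiff_resolventCoeff` and ✓`sum_frameD_resolventCoeff` apply to the cut-off `θ` (and to any `χ·θ`) with no further hypothesis. [folklore] -/
theorem tsupport_detLocaliser_subset (τ : ι → ((Fin (2 * L - 1 + 1) × Edge 3 L) ⊕ Site 3 L) → Matrix (Fin 2) (Fin 2) ℂ) (lam : ℝ) {δ : ℝ} (hδ : 0 < δ) :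
    tsupport (fun M : (Fin (2 * L - 1 + 1) → Edge 3 L → Matrix (Fin 2) (Fin 2) ℂ) × (Site 3 L → Matrix (Fin 2) (Fin 2) ℂ) =>
        1 - deficitStep ((frameHess (L := L) τ M + lam • (1 : Matrix ι ι ℝ)).det ^ 2 / δ)) ⊆
      {M | (frameHess (L := L) τ M + lam • (1 : Matrix ι ι ℝ)).det ≠ 0} := by
  -- the support lies in the CLOSED set `{δ/2 ≤ det²}`
  have hsub : Function.support (fun M : (Fin (2 * L - 1 + 1) → Edge 3 L → Matrix (Fin 2) (Fin 2) ℂ) × (Site 3 L → Matrix (Fin 2) (Fin 2) ℂ) =>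
        1 - deficitStep ((frameHess (L := L) τ M + lam • (1 : Matrix ι ι ℝ)).det ^ 2 / δ)) ⊆
      {M | δ / 2 ≤ (frameHess (L := L) τ M + lam • (1 : Matrix ι ι ℝ)).det ^ 2} := by
    intro M hM
    rw [Function.mem_support] at hM
    by_contra hlt
    rw [mem_setOf_eq, not_le] at hlt
    apply hM
    rw [deficitStep_eq_one (by rw [div_le_iff₀ hδ]; linarith), sub_self]
  have hclosed : IsClosed {M : (Fin (2 * L - 1 + 1) → Edge 3 L → Matrix (Fin 2) (Fin 2) ℂ) × (Site 3 L → Matrix (Fin 2) (Fin 2) ℂ) |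
      δ / 2 ≤ (frameHess (L := L) τ M + lam • (1 : Matrix ι ι ℝ)).det ^ 2} :=
    isClosed_le continuous_const (contDiff_det_shiftedHess_sq τ lam).continuous
  intro M hM
  have hM' : δ / 2 ≤ (frameHess (L := L) τ M + lam • (1 : Matrix ι ι ℝ)).det ^ 2 := (closure_minimal hsub hclosed) hM
  intro h0
  rw [h0] at hM'
  norm_num at hM'
  linarith

/-- At a point with `det(H + λ⋆1)² ≥ 2δ` (`δ > 0`) the localiser equals `1`. [folklore] -/
theorem detLocaliser_eq_one (τ : ι → ((Fin (2 * L - 1 + 1) × Edge 3 L) ⊕ Site 3 L) → Matrix (Fin 2) (Fin 2) ℂ) (lam : ℝ) {δ : ℝ} (hδ : 0 < δ)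
    {M : (Fin (2 * L - 1 + 1) → Edge 3 L → Matrix (Fin 2) (Fin 2) ℂ) × (Site 3 L → Matrix (Fin 2) (Fin 2) ℂ)}
    (hM : 2 * δ ≤ (frameHess (L := L) τ M + lam • (1 : Matrix ι ι ℝ)).det ^ 2) :
    1 - deficitStep ((frameHess (L := L) τ M + lam • (1 : Matrix ι ι ℝ)).det ^ 2 / δ) = 1 := by
  rw [deficitStep_eq_zero (by rw [le_div_iff₀ hδ]; linarith), sub_zero]

/-- ★ At a point with `det(H + λ⋆1)² ≥ 2δ` (`δ > 0`) every frame derivative of the localiser VANISHES (the step is flat there). [folklore] -/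
theorem frameD_detLocaliser_eq_zero (τ : ι → ((Fin (2 * L - 1 + 1) × Edge 3 L) ⊕ Site 3 L) → Matrix (Fin 2) (Fin 2) ℂ) (lam : ℝ) {δ : ℝ} (hδ : 0 < δ)
    {M : (Fin (2 * L - 1 + 1) → Edge 3 L → Matrix (Fin 2) (Fin 2) ℂ) × (Site 3 L → Matrix (Fin 2) (Fin 2) ℂ)}
    (hM : 2 * δ ≤ (frameHess (L := L) τ M + lam • (1 : Matrix ι ι ℝ)).det ^ 2)
    (Y : ((Fin (2 * L - 1 + 1) × Edge 3 L) ⊕ Site 3 L) → Matrix (Fin 2) (Fin 2) ℂ) :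
    frameD Y (fun M' : (Fin (2 * L - 1 + 1) → Edge 3 L → Matrix (Fin 2) (Fin 2) ℂ) × (Site 3 L → Matrix (Fin 2) (Fin 2) ℂ) =>
      1 - deficitStep ((frameHess (L := L) τ M' + lam • (1 : Matrix ι ι ℝ)).det ^ 2 / δ)) M = 0 := by
  rw [frameD_one_sub, frameD_deficitStep_comp (contDiff_det_shiftedHess_sq τ lam),
    deriv_deficitStep_eq_zero_of_one_lt (by rw [lt_div_iff₀ hδ]; linarith)]
  simp

end DetLocaliser

/-! ## §4 The deficit-level cut-off `ψ(ringPoly/t₀)` -/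

/-- On `{F₀ ≤ t₀/2}` the deficit cut-off equals `1`. [folklore] -/
theorem deficitLevel_eq_one {t₀ : ℝ} (ht₀ : 0 < t₀)
    {M : (Fin (2 * L - 1 + 1) → Edge 3 L → Matrix (Fin 2) (Fin 2) ℂ) × (Site 3 L → Matrix (Fin 2) (Fin 2) ℂ)} (hM : ringPoly L M ≤ t₀ / 2) :
    deficitStep (ringPoly L M / t₀) = 1 :=
  deficitStep_eq_one (by rw [div_le_iff₀ ht₀]; linarith)

/-- Where the cut-off does not vanish, `F₀ < t₀`. [folklore] -/
theorem ringPoly_lt_of_deficitLevel_ne_zero {t₀ : ℝ} (ht₀ : 0 < t₀)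
    {M : (Fin (2 * L - 1 + 1) → Edge 3 L → Matrix (Fin 2) (Fin 2) ℂ) × (Site 3 L → Matrix (Fin 2) (Fin 2) ℂ)} (hM : deficitStep (ringPoly L M / t₀) ≠ 0) :
    ringPoly L M < t₀ := by
  by_contra h
  rw [not_lt] at h
  exact hM (deficitStep_eq_zero (by rwa [le_div_iff₀ ht₀, one_mul]))

/-- Where the DERIVATIVE of the cut-off does not vanish, `F₀ ≤ t₀` (the step is flat beyond `1`). [folklore] -/
theorem ringPoly_le_of_deriv_deficitLevel_ne_zero {t₀ : ℝ} (ht₀ : 0 < t₀)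
    {M : (Fin (2 * L - 1 + 1) → Edge 3 L → Matrix (Fin 2) (Fin 2) ℂ) × (Site 3 L → Matrix (Fin 2) (Fin 2) ℂ)} (hM : deriv deficitStep (ringPoly L M / t₀) ≠ 0) :
    ringPoly L M ≤ t₀ := by
  by_contra h
  rw [not_le] at h
  exact hM (deriv_deficitStep_eq_zero_of_one_lt (by rwa [lt_div_iff₀ ht₀, one_mul]))

/-- On `{F₀ > t₀}` the cut-off vanishes together with all its frame derivatives. [folklore] -/
theorem deficitLevel_eq_zero_and_frameD_eq_zero {t₀ : ℝ} (ht₀ : 0 < t₀)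
    {M : (Fin (2 * L - 1 + 1) → Edge 3 L → Matrix (Fin 2) (Fin 2) ℂ) × (Site 3 L → Matrix (Fin 2) (Fin 2) ℂ)} (hM : t₀ < ringPoly L M)
    (Y : ((Fin (2 * L - 1 + 1) × Edge 3 L) ⊕ Site 3 L) → Matrix (Fin 2) (Fin 2) ℂ) :
    deficitStep (ringPoly L M / t₀) = 0 ∧ frameD Y (fun M' => deficitStep (ringPoly L M' / t₀)) M = 0 := by
  have h1 : 1 < ringPoly L M / t₀ := by rwa [lt_div_iff₀ ht₀, one_mul]
  refine ⟨deficitStep_eq_zero h1.le, ?_⟩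
  rw [frameD_deficitStep_comp (contDiff_ringPoly (L := L)), deriv_deficitStep_eq_zero_of_one_lt h1]
  simp

end Summit.QuantumFields.YangMills.Theorems.VirialFluxGap.FrameHessian

end
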